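import Summits.BirchSwinnertonDyer.BirchSwinnertonDyer.Theorems.EisensteinPrimesResidualDevissageCountNonsplit
import Summits.BirchSwinnertonDyer.BirchSwinnertonDyer.Theorems.EisensteinPrimesCharResidualSelmerFinite
import Summits.BirchSwinnertonDyer.Rank1Residual.Iwasawa.MuZeroQuotientCard
import HarnessLib

/-!
# `p^{λ(𝔛)} · #𝔛[p] = #S^{S₀}_M(K_∞)[p]` for a Greenberg–Vatsal dual datum `𝔛` of the datum Selmer group —
# the CHARACTER-SIDE exact count of the residual road to Keller–Yin Thm. 1.4.1 (iii)
# (cell `bsd-eis`, seat `bsd-line-x1-p1` LEAD g3, D-0154 KEY row 4; crux 2 `GoodLatticeBDPValue`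
# stmt-BirchSwinnertonDyer-19032, line `halves` v19.1, stub `stub_imprimLambda` = KY Thm. 1.4.1 (iii), V20 road brick (a))

HONEST FRAMING (cell `bsd-eis`, run/shared/lean/pub/bsd-eis/): module-theoretic bookkeeping; no definition, no
named fact, no `sorry`, no `Theses` import; nothing about BSD / IMC2 / KY Thm. 1.4.1 (iii) is proved. Helper
`--supports stmt-BirchSwinnertonDyer-19032`; closes no registered stub.

## Why / what
KY's proof of the `λ`-identity (iii) reads every `λ(𝔛^S_?)` through the residual Selmer group:
«`λ(𝔛^S_?) = dim_𝔽 Sel(M_?)[𝔭] − dim_𝔽 Sel(M_?)/𝔭`» (arXiv:2402.12781v2 TeX L1162–1170, the structure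
theorem with `μ = 0`). The `E`-side of that dictionary is in the tree for Castella's `X_ac^Σ`
(`ResidualDevissageCountNonsplit.pow_lambdaInvariant_mul_natCard_pTorsion_eq`, seat bsd-line-x2-p2 g5, p635607:
`p^{λ(X)} · #X[p] = #Sel_𝔭^Σ(K_∞, E[p^∞])[p]`, reduction-type-free). This file is its TWIN for the character side
of the line: for ANY Greenberg–Vatsal dual datum `D` (`GreenbergVatsal2000.DatumDualData κ γ M L S₀`) of a datum
Selmer group `S^{S₀}_M(K_∞)` that is finitely generated `Λ`-torsion with `μ = 0`,
`p ^ λ(D.X) · #{x ∈ D.X | p x = 0} = #{s ∈ S^{S₀}_M(K_∞) | p s = 0}` (`pow_lambdaInvariant_mul_natCard_pTorsion_eq`):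
`μ = 0` ⟹ `D.X` finitely generated over `ℤ_p` (Washington §13.2, tree `muInvariant_eq_zero_iff_finite`);
`#(X/pX) = p^{λ(X)} · #X[p]` (the cell's Herbrand count `LambdaLowerBound.natCard_quotient_eq_pow_lambdaInvariant_mul_natCard_ker`);
`#(X/pX) = #(Hom(Sel, ℚ/ℤ)/p) = #Sel[p]` (transport along `D.toDualEquiv`, then the unconditional Pontryagin
count `Iwasawa.natCard_modN_characterModule_eq`). Specialised to `unrSelmer κ (charModule ∅ θ) v̄ S₀`
(= `datumSelmerInfty … (bdpData …) S₀`) and to the `∀`-form the line carries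
(`pow_lambdaInvariant_mul_natCard_pTorsion_eq_of_forall`).

References: [KellerYin2024] §1.4 (TeX L1162–1181, Lemma `Seltolambda`); [GreenbergVatsal2000] §2 Prop. (2.8)
(proof, p. 27); [Washington1997] §13.2; [LimSujatha2018] §3.
-/

set_option autoImplicit false
set_option linter.dupNamespace false -- the summit namespace `…BirchSwinnertonDyer.BirchSwinnertonDyer.Theorems` (Sub = Summit, D-0017) trips it

noncomputable section

open scoped Classical

namespace Summit.BirchSwinnertonDyer.BirchSwinnertonDyer.Theorems.CharDualExactCount

open NumberField IsDedekindDomain Field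
open Literature.NumberTheory.EllipticCurves Literature.NumberTheory.EllipticCurves.IwasawaAlgebra
  Literature.NumberTheory.EllipticCurves.GreenbergSelmer Literature.NumberTheory.EllipticCurves.GreenbergVatsal2000
  Literature.NumberTheory.GaloisRepresentations Literature.NumberTheory.EllipticCurves.KellerYin2024
  Summit.BirchSwinnertonDyer.BirchSwinnertonDyer.Theorems Summit.BirchSwinnertonDyer.Rank1Residual.Iwasawa

variable {K : Type} [Field K] [NumberField K] {p : ℕ} [hp : Fact p.Prime] {κ : ZpExtension K p}
  {γ : absoluteGaloisGroup K} {M : Type} [AddCommGroup M] [DistribMulAction (absoluteGaloisGroup K) M]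
  [TopologicalSpace M] [DiscreteTopology M] {L : Data K M p} {S₀ : Set (HeightOneSpectrum (𝓞 K))}

/-- **`#(X/pX) = #S^{S₀}_M(K_∞)[p]` for a dual datum `X = D.X`** (Pontryagin, unconditional): transport
`X/pX ≅ Hom(Sel, ℚ/ℤ)/p` along `D.toDualEquiv` (`Submodule.Quotient.equiv` for the images of multiplication by
`p`), then `#(Hom(Sel, ℚ/ℤ)/p) = #Sel[p]` (`Iwasawa.natCard_modN_characterModule_eq`).
[cite: GreenbergVatsal2000, §2 p. 17 (the Pontryagin dual as a Λ-module)] [cite: Washington1997, §13.2] -/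
theorem natCard_modN_eq_natCard_pTorsion (D : DatumDualData κ γ M L S₀) :
    Nat.card (ModN D.X p) = Nat.card {s : datumSelmerInfty κ M L S₀ // p • s = 0} := by
  let e : D.X ≃ₗ[ℤ] CharacterModule (datumSelmerInfty κ M L S₀) := D.toDualEquiv.toIntLinearEquiv
  have hmap : (LinearMap.range (LinearMap.lsmul ℤ D.X p)).map (e : D.X →ₗ[ℤ] _) =
      LinearMap.range (LinearMap.lsmul ℤ (CharacterModule (datumSelmerInfty κ M L S₀)) p) := by
    ext χ
    simp only [Submodule.mem_map, LinearMap.mem_range, LinearMap.lsmul_apply]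
    constructor
    · rintro ⟨x, ⟨a, rfl⟩, rfl⟩
      exact ⟨e a, by change (p : ℤ) • e a = e ((p : ℤ) • a); rw [map_zsmul]⟩
    · rintro ⟨b, rfl⟩
      exact ⟨(p : ℤ) • e.symm b, ⟨e.symm b, rfl⟩, by
        change e ((p : ℤ) • e.symm b) = (p : ℤ) • b
        rw [map_zsmul, LinearEquiv.apply_symm_apply]⟩
  rw [Nat.card_congr (Submodule.Quotient.equiv _ _ e hmap).toEquiv, natCard_modN_characterModule_eq]
  exact Nat.card_congr (Equiv.subtypeEquivRight fun s ↦ AddSubgroup.torsionBy.nsmul_iff)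

/-- **`p^{λ(X)} · #X[p] = #S^{S₀}_M(K_∞)[p]` for a finitely generated torsion dual datum `X = D.X` with
`μ = 0`** — the character-side twin of `ResidualDevissageCountNonsplit.pow_lambdaInvariant_mul_natCard_pTorsion_eq`
(KY: «`λ(𝔛^S_?) = dim Sel(M_?)[𝔭] − dim Sel(M_?)/𝔭`», the second dimension being `dim X[p]` by duality).
`μ = 0` ⟹ `X` f.g. over `ℤ_p`; Herbrand `#(X/pX) = p^λ · #X[p]`; Pontryagin `#(X/pX) = #Sel[p]`.
[cite: KellerYin2024, §1.4 (arXiv:2402.12781v2 TeX L1162–1170)] [cite: GreenbergVatsal2000, §2 Prop. (2.8) (proof, p. 27)]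
[cite: Washington1997, §13.2] -/
theorem pow_lambdaInvariant_mul_natCard_pTorsion_eq (D : DatumDualData κ γ M L S₀)
    [Module.Finite (IwasawaAlgebra p) D.X] (hT : Module.IsTorsion (IwasawaAlgebra p) D.X)
    (hμ : muInvariant p D.X = 0) :
    p ^ lambdaInvariant p D.X * Nat.card {x : D.X // p • x = 0} =
      Nat.card {s : datumSelmerInfty κ M L S₀ // p • s = 0} := by
  letI : Module ℤ_[p] D.X := Module.compHom D.X (algebraMap ℤ_[p] (IwasawaAlgebra p))
  haveI : IsScalarTower ℤ_[p] (IwasawaAlgebra p) D.X := IsScalarTower.of_compHom _ _ _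
  haveI : Module.Finite ℤ_[p] D.X := (muInvariant_eq_zero_iff_finite p D.X hT).mp hμ
  have hsm : ∀ x : D.X, (p : ℤ_[p]) • x = p • x := fun x ↦ by
    change (algebraMap ℤ_[p] (IwasawaAlgebra p) (p : ℤ_[p])) • x = _
    rw [map_natCast, Nat.cast_smul_eq_nsmul]
  have hH := LambdaLowerBound.natCard_quotient_eq_pow_lambdaInvariant_mul_natCard_ker p D.X
  have h2 : Nat.card (D.X ⧸ LinearMap.range (LinearMap.lsmul ℤ_[p] D.X p)) =
      Nat.card (D.X ⧸ (Ideal.span {(p : ℤ_[p])} • ⊤ : Submodule ℤ_[p] D.X)) :=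
    Nat.card_congr (Submodule.quotEquivOfEq _ _
      (LambdaLowerBound.span_smul_top_eq_range_lsmul p D.X).symm).toEquiv
  have h3 : Nat.card (D.X ⧸ (Ideal.span {(p : ℤ_[p])} • ⊤ : Submodule ℤ_[p] D.X)) =
      Nat.card (D.X ⧸ (Ideal.span {PowerSeries.C (p : ℤ_[p])} • ⊤ : Submodule (IwasawaAlgebra p) D.X)) := by
    change Nat.card (D.X ⧸ (Ideal.span {(p : ℤ_[p])} • ⊤ : Submodule ℤ_[p] D.X).toAddSubgroup) =
      Nat.card (D.X ⧸ (Ideal.span {PowerSeries.C (p : ℤ_[p])} • ⊤ :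
        Submodule (IwasawaAlgebra p) D.X).toAddSubgroup)
    rw [PrintCFram.LambdaResidualBound.toAddSubgroup_pSmul_eq p D.X]
  have h4 : Nat.card (D.X ⧸ (Ideal.span {PowerSeries.C (p : ℤ_[p])} • ⊤ : Submodule (IwasawaAlgebra p) D.X)) =
      Nat.card {s : datumSelmerInfty κ M L S₀ // p • s = 0} := by
    rw [show (Ideal.span {PowerSeries.C (p : ℤ_[p])} : Ideal (IwasawaAlgebra p)) = augIdealP p from rfl,
      natCard_quotient_augIdealP_smul_top_eq_natCard_modN p, natCard_modN_eq_natCard_pTorsion]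
  have h5 : Nat.card (LinearMap.ker (LinearMap.lsmul ℤ_[p] D.X p)) = Nat.card {x : D.X // p • x = 0} :=
    Nat.card_congr (Equiv.subtypeEquivRight fun x ↦ by rw [LinearMap.mem_ker, LinearMap.lsmul_apply, hsm])
  rw [← h5, ← hH, h2, h3, h4]

/-- **The same for Keller–Yin's `H¹_{𝓕_nr^{S₀}}(K_∞, (F/𝒪)(θ))` in the `∀`-form the line carries**: if every
dual datum of `unrSelmer κ (charModule ∅ θ) v̄ S₀` is finitely generated `Λ`-torsion with `μ = 0` (the first
clause of `prop125_residualPair_unrSelmer_imprimitive`, kernel modulo PUB in the `halves` line), then for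
every such datum `D`: `p^{λ(D.X)} · #D.X[p] = #H¹_{𝓕_nr^{S₀}}(K_∞, (F/𝒪)(θ))[p]` (a finite number by
`CharResidualSelmerFinite.finite_pTorsion_of_muInvariant_eq_zero`). [cite: KellerYin2024, Prop. 1.2.5 and §1.4 Lemma (Seltolambda) (arXiv:2402.12781v2 TeX L780–800, L1170–1181)] -/
theorem pow_lambdaInvariant_mul_natCard_pTorsion_eq_of_forall
    (θ : FramedGaloisRep K (padicCoeffIntegers (∅ : Set (PadicAlgCl p))) 1)
    (vbar : HeightOneSpectrum (𝓞 K)) (S₁ : Set (HeightOneSpectrum (𝓞 K)))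
    (hS : ∀ D : DatumDualData κ γ (charModule (∅ : Set (PadicAlgCl p)) θ)
      (Literature.NumberTheory.EllipticCurves.Castella2018.AcSelmer.bdpData
        (charModule (∅ : Set (PadicAlgCl p)) θ) p vbar) S₁,
      Module.Finite (IwasawaAlgebra p) D.X ∧ Module.IsTorsion (IwasawaAlgebra p) D.X ∧
        muInvariant p D.X = 0)
    (D : DatumDualData κ γ (charModule (∅ : Set (PadicAlgCl p)) θ)
      (Literature.NumberTheory.EllipticCurves.Castella2018.AcSelmer.bdpData
        (charModule (∅ : Set (PadicAlgCl p)) θ) p vbar) S₁) :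
    p ^ lambdaInvariant p D.X * Nat.card {x : D.X // p • x = 0} =
      Nat.card {s : unrSelmer κ (charModule (∅ : Set (PadicAlgCl p)) θ) vbar S₁ // p • s = 0} := by
  obtain ⟨hfg, hT, hμ⟩ := hS D
  haveI := hfg
  exact pow_lambdaInvariant_mul_natCard_pTorsion_eq D hT hμ

end Summit.BirchSwinnertonDyer.BirchSwinnertonDyer.Theorems.CharDualExactCount

end
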